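import Literature.MathematicalPhysics.QuantumFieldTheory.WilsonEnergyConvexity
import Literature.MathematicalPhysics.QuantumFieldTheory.YangMillsOS
import HarnessLib

/-!
# The one-link Haar-shift (finite-difference Schwinger–Dyson) identity for Wilson's torus measure

Route `EquipartitionCriticality` of `YangMills`, crux item `stmt-QuantumFields-8760`
(`Summit.QuantumFields.YangMills.Theses.EquipartitionCriticality.EquipartitionPinsProbe`), line
`Sketch`: a helper toward the line's physics stub `stub_localLaw` (the local free-gluon law), whose
every proposed proof (crux idea cards `stein-liouville-pinning`, `sd-bochner-covariance-rigidity`,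
`heat-bath-gibbs-pythagoras`, `langevin-local-equilibration`) starts from the exact finite-`β`
integration-by-parts identity on ONE link.

What is proved (`haarShift_wilsonExpectation`): for every compact group `G`, continuous matrix
representation `ρ`, torus `(ℤ/L)^d`, coupling `β`, edge `e`, group element `g` and EVERY real
observable `f`, left-multiplying the link variable `U_e` by `g` inside `f` is the same as reweighting
`f` by the Boltzmann factor of the inverse shift:
`⟨f(U^{g,e})⟩_β = ⟨f(U) · exp(−β (S(U^{g⁻¹,e}) − S(U)))⟩_β`, `U^{g,e} := update U e (g · U_e)`.
Proof: `⟨X⟩_β = ∫ X e^{−βS} dHaar^{⊗E} / Z` (`wilsonExpectation_eq_integral_div`, valid for every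
`X`), and the shift `U ↦ U^{g,e}` is a measurable equivalence preserving the product Haar measure
(left invariance of Haar in the coordinate `e`, Mathlib `measurePreserving_pi`,
`measurePreserving_mul_left`), so the two numerators agree by the change of variables
`V = U^{g,e}` (`MeasurePreserving.integral_comp`). No measurability or boundedness of `f` is
needed (both sides are the same possibly-junk Bochner integral).
-/

noncomputable section

open MeasureTheory

namespace Summit.QuantumFields.YangMills.Theorems.EquipartitionPinsProbe

namespace HaarShift

open Literature.MathematicalPhysics.QuantumFieldTheory

variable {G : Type*} [Group G]

/-- The one-link left shift `U ↦ U^{g,e}`, `U^{g,e}_e = g U_e`, `U^{g,e}_{e'} = U_{e'}` otherwise, is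
measurable (torus gauge configurations carry the product σ-algebra). -/
theorem measurable_update_mul [MeasurableSpace G] [MeasurableMul G] {d L : ℕ} (e : Edge d L) (g : G) :
    Measurable fun U : GaugeConfig d L G => Function.update U e (g * U e) := by
  refine measurable_pi_iff.2 fun i => ?_
  by_cases h : i = e
  · subst h
    simp only [Function.update_self]
    exact (measurable_const_mul g).comp (measurable_pi_apply (X := fun _ : Edge d L => G) i)
  · simp only [Function.update_of_ne h]
    exact measurable_pi_apply i

/-- Shifting by `g⁻¹` undoes the shift by `g`. -/
theorem update_mul_update_mul {d L : ℕ} (e : Edge d L) (g h : G) (U : GaugeConfig d L G) :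
    Function.update (Function.update U e (g * U e)) e (h * Function.update U e (g * U e) e) =
      Function.update U e (h * g * U e) := by
  rw [Function.update_idem, Function.update_self, mul_assoc]

/-- The shift by `g` followed by the shift by `g⁻¹` is the identity. -/
theorem update_inv_mul_update_mul {d L : ℕ} (e : Edge d L) (g : G) (U : GaugeConfig d L G) :
    Function.update (Function.update U e (g * U e)) e (g⁻¹ * Function.update U e (g * U e) e) = U := by
  rw [update_mul_update_mul, inv_mul_cancel, one_mul, Function.update_eq_self]

end HaarShift

open Literature.MathematicalPhysics.QuantumFieldTheory in
/-- **The one-link Haar-shift identity** (finite-difference Schwinger–Dyson equation on the torus):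
for Wilson's measure `μ_β ∝ e^{−βS} dHaar^{⊗E}` on `(ℤ/L)^d`, every edge `e`, every `g ∈ G` and every
real observable `f`,
`∫ f(update U e (g·U_e)) dμ_β = ∫ f(U) · exp(−β (S(update U e (g⁻¹·U_e)) − S(U))) dμ_β`.
Its derivative at `g = exp(tX)` is the one-link integration-by-parts identity
`E[∇_{e,X} f] = β E[f ∇_{e,X} S]`, whose `β → ∞` limit is Stein's equation for the free gluon field. -/
theorem haarShift_wilsonExpectation :
    ∀ (G : Type) [Group G] [TopologicalSpace G] [IsTopologicalGroup G] [CompactSpace G]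
      [MeasurableSpace G] [BorelSpace G] {N : ℕ} (ρ : G →* Matrix (Fin N) (Fin N) ℂ), Continuous ρ →
      ∀ (d L : ℕ) [NeZero L] (β : ℝ) (e : Literature.MathematicalPhysics.QuantumFieldTheory.Edge d L)
        (g : G) (f : Literature.MathematicalPhysics.QuantumFieldTheory.GaugeConfig d L G → ℝ),
        ∫ U, f (Function.update U e (g * U e))
            ∂(Literature.MathematicalPhysics.QuantumFieldTheory.wilsonMeasure (d := d) (L := L) ρ β) =
          ∫ U, f U * Real.exp (-(β *
              (Literature.MathematicalPhysics.QuantumFieldTheory.wilsonAction (d := d) (L := L) ρ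
                  (Function.update U e (g⁻¹ * U e)) -
                Literature.MathematicalPhysics.QuantumFieldTheory.wilsonAction (d := d) (L := L) ρ U)))
            ∂(Literature.MathematicalPhysics.QuantumFieldTheory.wilsonMeasure (d := d) (L := L) ρ β) := by
  intro G _ _ _ _ _ _ N ρ hρ d L _ β e g f
  -- both sides as Gibbs averages against product Haar measure
  have hL := wilsonExpectation_eq_integral_div (d := d) (L := L) ρ hρ β
    (fun U => f (Function.update U e (g * U e)))
  have hR := wilsonExpectation_eq_integral_div (d := d) (L := L) ρ hρ β
    (fun U => f U * Real.exp (-(β * (wilsonAction (d := d) (L := L) ρ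
      (Function.update U e (g⁻¹ * U e)) - wilsonAction (d := d) (L := L) ρ U))))
  unfold wilsonExpectation at hL hR
  rw [hL, hR]
  congr 1
  -- the shift by `g` preserves the product Haar measure
  set π : Measure (GaugeConfig d L G) := Measure.pi fun _ : Edge d L => haarProbability G with hπ
  have hmp : MeasurePreserving (fun U : GaugeConfig d L G => Function.update U e (g * U e)) π π := by
    have key := measurePreserving_pi (fun _ : Edge d L => haarProbability G)
      (fun _ : Edge d L => haarProbability G)
      (f := fun i (x : G) => if i = e then g * x else x) (fun i => by
        by_cases h : i = e
        · simp only [h, ↓reduceIte]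
          exact measurePreserving_mul_left (haarProbability G) g
        · simp only [h, ↓reduceIte]
          exact MeasurePreserving.id _)
    have hfun : (fun (a : GaugeConfig d L G) (i : Edge d L) => if i = e then g * a i else a i) =
        fun U => Function.update U e (g * U e) := by
      funext U i
      by_cases h : i = e
      · subst h; simp
      · simp [h]
    rw [hfun] at key
    exact key
  -- as a measurable equivalence (inverse = shift by `g⁻¹`)
  let T : GaugeConfig d L G ≃ᵐ GaugeConfig d L G :=
    { toFun := fun U => Function.update U e (g * U e)
      invFun := fun U => Function.update U e (g⁻¹ * U e)
      left_inv := fun U => HaarShift.update_inv_mul_update_mul e g U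
      right_inv := fun U => by
        have h := HaarShift.update_inv_mul_update_mul e g⁻¹ U
        rwa [inv_inv] at h
      measurable_toFun := HaarShift.measurable_update_mul e g
      measurable_invFun := HaarShift.measurable_update_mul e g⁻¹ }
  have hT : MeasurePreserving T π π := hmp
  -- change of variables `V = T U` in the right-hand numerator
  have hcv := hT.integral_comp' (fun V : GaugeConfig d L G =>
    f V * Real.exp (-(β * (wilsonAction (d := d) (L := L) ρ (Function.update V e (g⁻¹ * V e)) -
      wilsonAction (d := d) (L := L) ρ V))) * Real.exp (-β * wilsonAction (d := d) (L := L) ρ V))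
  rw [← hcv]
  refine integral_congr_ae (ae_of_all _ fun U => ?_)
  -- pointwise: `T⁻¹ (T U) = U` and the Boltzmann factors telescope
  show f (Function.update U e (g * U e)) * Real.exp (-β * wilsonAction ρ U) =
    f (Function.update U e (g * U e)) *
      Real.exp (-(β * (wilsonAction ρ (Function.update (Function.update U e (g * U e)) e
        (g⁻¹ * Function.update U e (g * U e) e)) - wilsonAction ρ (Function.update U e (g * U e))))) *
      Real.exp (-β * wilsonAction ρ (Function.update U e (g * U e)))
  rw [HaarShift.update_inv_mul_update_mul, mul_assoc, ← Real.exp_add]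
  congr 2
  ring

end Summit.QuantumFields.YangMills.Theorems.EquipartitionPinsProbe

end
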